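import Mathlib.LinearAlgebra.Eigenspace.Triangularizable
import Mathlib.Analysis.Complex.Polynomial.Basic
import Mathlib.LinearAlgebra.Dual.Lemmas
import Literature.NumberTheory.Automorphic.LocalConstants
import Literature.NumberTheory.GaloisRepresentations.WeilDeligneRepProofs
import HarnessLib

/-!
# Route IrreducibilityBySelfDuality — `ReciprocityUpToIrreducibilityR` (stmt-Langlands-17925), line `Sketch`:
# stub E1 `stub_eulerFactor_tprod_eq_one_of_isIrreducible` (`--supports` file; no definitions)

**Henniart 2002, Thm 1.6 (a), elementary half (i) ⇒ (ii), in Euler-factor form.**  Let `φ` be an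
IRREDUCIBLE Weil–Deligne representation of `W_F` on a finite-dimensional complex space `V` and
`τ` ANY Weil–Deligne representation on `W` with `dim W < dim V`.  Then the Euler factor
`det(1 - T·Φ | (ker N)^{I_F})` of `φ ⊗ τ` is `1`, i.e. `(ker N_{φ⊗τ})^{I_F} = 0`.

Proof (pure linear algebra, all ingredients proved in the tree / Mathlib):

* `N_eq_zero_of_isIrreducible`: `ker N_φ` is a sub-Weil–Deligne representation (the relation
  `ρ(w) N = q^{deg w} N ρ(w)`), non-zero since `N_φ` is nilpotent on `V ≠ 0`; so `N_φ = 0`.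
* `exists_forall_exists_smul_of_ne_bot`: if `U = (ker N)^{I_F} ≠ 0` (for any Weil–Deligne
  representation `r`), an eigenvector `u ∈ U` of the geometric Frobenius `Φ` spans a `W_F`-stable
  LINE: the set of `w` acting on `u` by a scalar is a subgroup containing `I_F` (trivial on `U`)
  and `Φ`, hence everything (`deg Φ^{-k} = k` and `deg w = deg w' ⇒ w w'⁻¹ ∈ I_F`, from the
  discharged facts `IsFrobPow.mul_holds` / `unique_holds` via `WeilGroup.degHom`,
  `WeilGroup.mul_inv_mem_inertia_of_deg_eq`).
* `eq_zero_of_forall_exists_smul`: a `W_F`-stable line `ℂu ≤ V ⊗ W` contradicts irreducibility of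
  `φ` when `dim W < dim V`: the contractions `f ↦ (id ⊗ f) u`, `f ∈ W^*`, form a linear map
  `W^* → V` whose range is `ρ_φ`-stable (`ρ_φ(w) ∘ c_f = c_{f ∘ ρ_τ(w⁻¹)} ∘ (ρ_φ ⊗ ρ_τ)(w)`),
  `N_φ`-stable (`N_φ = 0`), of dimension `≤ dim W < dim V`, and non-zero unless `u = 0`
  (`u = Σ_i c_{b^*_i}(u) ⊗ b_i` for a basis `b` of `W`).
* `eulerFactor_eq_one_of_inertiaInvariantsKerN_eq_bot`: on the zero space the characteristic
  polynomial is `1` (`WeilDeligneRep.eulerFactor_eq_reverse_charpoly`, `LinearMap.charpoly_natDegree`).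

Source: G. Henniart, *Une caractérisation de la correspondance de Langlands locale pour `GL(n)`*,
Bull. Soc. Math. France 130 (2002), Thm 1.6 (a); J. Tate, *Number theoretic background*
(Corvallis 1979), (4.1.6).  Standard axioms only; no `sorry`.
-/

noncomputable section

set_option linter.dupNamespace false

open scoped TensorProduct
open Module Polynomial
open Literature.NumberTheory.Automorphic Literature.NumberTheory.GaloisRepresentations
open Literature.NumberTheory.GaloisRepresentations.WeilGroup
open Literature.NumberTheory.GaloisRepresentations.IsNonarchimedeanLocalField

namespace Summit.Langlands.Langlands.Theorems.ReciprocityUpToIrreducibilityR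

/-- **An irreducible Weil–Deligne representation has trivial monodromy.**  `ker N` is stable under
every `ρ(w)` (Weil–Deligne relation `ρ(w) N = q^{deg w} N ρ(w)` with `q^{deg w} ≠ 0`) and under `N`,
and it is non-zero because `N` is nilpotent on the non-zero space `V`; irreducibility forces
`ker N = V`.  Ref: Tate, *Number theoretic background* (Corvallis 1979), (4.1.3)–(4.1.5).
[cite: Corvallis1979, (4.1.5)] -/
theorem N_eq_zero_of_isIrreducible {F : Type*} [Field F] [ValuativeRel F] [TopologicalSpace F]
    [IsNonarchimedeanLocalField F] {C : Type*} [Field C] [CharZero C] {V : Type*}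
    [AddCommGroup V] [Module C V] (φ : WeilDeligneRep F C V) (hφ : φ.IsIrreducible) :
    φ.N = 0 := by
  obtain ⟨hV, hirr⟩ := hφ
  have hsub : φ.IsSubrep (LinearMap.ker φ.N) := by
    refine ⟨fun w v hv => ?_, fun v hv => ?_⟩
    · rw [LinearMap.mem_ker] at hv
      rw [Submodule.mem_comap, LinearMap.mem_ker]
      have h := φ.ρ_N_apply w v
      rw [hv, map_zero] at h
      exact (smul_eq_zero.mp h.symm).resolve_left
        (WeilDeligneRep.residueFieldCard_zpow_ne_zero (deg w))
    · rw [Submodule.mem_comap, LinearMap.mem_ker, LinearMap.mem_ker.mp hv, map_zero]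
  rcases hirr _ hsub with h | h
  · exfalso
    obtain ⟨k, hk⟩ := φ.isNilpotent_N
    have hinj : Function.Injective (φ.N ^ k) := by
      rw [Module.End.coe_pow]
      exact (LinearMap.ker_eq_bot.mp h).iterate k
    rw [hk] at hinj
    obtain ⟨x, y, hxy⟩ := exists_pair_ne V
    exact hxy (hinj rfl)
  · exact LinearMap.ker_eq_top.mp h

/-- **A non-zero `(ker N)^{I_F}` contains a `W_F`-stable line.**  For any Weil–Deligne representation
`r` on a finite-dimensional complex space with `U = (ker N)^{I_F} ≠ 0`, an eigenvector `u ∈ U` of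
the geometric Frobenius `Φ` (which preserves `U`) satisfies `ρ(w) u ∈ ℂ u` for EVERY `w ∈ W_F`:
the `w` acting on `u` by a scalar form a subgroup containing `I_F` (trivial on `U`) and `Φ`, and
`W_F = ⋃_k I_F Φ^k` (`deg Φ^{-k} = k`, `deg w = deg w' ⇒ w w'⁻¹ ∈ I_F`; discharged facts
`IsFrobPow.mul_holds`, `IsFrobPow.unique_holds`).
Ref: Tate, *Number theoretic background* (Corvallis 1979), (1.4.1), (4.1.6). [cite: Corvallis1979, (4.1.6)] -/
theorem exists_forall_exists_smul_of_ne_bot {F : Type*} [Field F] [ValuativeRel F]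
    [TopologicalSpace F] [IsNonarchimedeanLocalField F]
    (hn : absInertia_normal F) (hex : exists_isFrobPow (F := F))
    {X : Type*} [AddCommGroup X] [Module ℂ X] [FiniteDimensional ℂ X] (r : WeilDeligneRep F ℂ X)
    (hU : r.inertiaInvariantsKerN ≠ ⊥) :
    ∃ u : X, u ≠ 0 ∧ ∀ w : WeilGroup F, ∃ a : ℂ, r.ρ w u = a • u := by
  haveI : Nontrivial r.inertiaInvariantsKerN := Submodule.nontrivial_iff_ne_bot.mpr hU
  obtain ⟨c, hc⟩ := Module.End.exists_eigenvalue
    (r.restrictInertiaInvariantsKerN hn (WeilDeligneRep.geomFrob F hex))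
  obtain ⟨u₀, hu₀⟩ := hc.exists_hasEigenvector
  have hu : (u₀ : X) ≠ 0 := mt Submodule.coe_eq_zero.mp hu₀.2
  have hΦ : r.ρ (WeilDeligneRep.geomFrob F hex) u₀ = c • (u₀ : X) := by
    simpa using congrArg Subtype.val hu₀.apply_eq_smul
  -- the subgroup of `w` acting on `u₀` by a scalar
  let S : Subgroup (WeilGroup F) :=
    { carrier := {w | ∃ a : ℂ, r.ρ w u₀ = a • (u₀ : X)}
      mul_mem' := fun {w w'} hw hw' => by
        obtain ⟨a, ha⟩ := hw
        obtain ⟨a', ha'⟩ := hw'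
        exact ⟨a' * a, by rw [map_mul, Module.End.mul_apply, ha', map_smul, ha, smul_smul]⟩
      one_mem' := ⟨1, by rw [map_one, Module.End.one_apply, one_smul]⟩
      inv_mem' := fun {w} hw => by
        obtain ⟨a, ha⟩ := hw
        have ha0 : a ≠ 0 := by
          rintro rfl
          rw [zero_smul] at ha
          exact hu (by rw [← r.ρ.inv_self_apply w (u₀ : X), ha, map_zero])
        refine ⟨a⁻¹, smul_right_injective X ha0 ?_⟩
        show a • r.ρ w⁻¹ (u₀ : X) = a • (a⁻¹ • (u₀ : X))
        rw [← map_smul, ← ha, r.ρ.inv_self_apply, smul_smul, mul_inv_cancel₀ ha0, one_smul] }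
  have hI : inertia F ≤ S := fun i hi =>
    ⟨1, by rw [one_smul]; exact ((r.mem_inertiaInvariantsKerN_iff _).mp u₀.2).2 i hi⟩
  have hΦS : WeilDeligneRep.geomFrob F hex ∈ S := ⟨c, hΦ⟩
  have hdeg : ∀ k : ℤ, deg (WeilDeligneRep.geomFrob F hex ^ k) = -k := fun k => by
    have h := map_zpow (degHom F IsFrobPow.mul_holds IsFrobPow.unique_holds)
      (WeilDeligneRep.geomFrob F hex) k
    rw [degHom_apply, degHom_apply, WeilDeligneRep.deg_geomFrob' hex, ← ofAdd_zsmul] at h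
    rw [Multiplicative.ofAdd.injective h, smul_eq_mul, mul_neg, mul_one]
  have hS : ∀ w : WeilGroup F, w ∈ S := fun w => by
    have h1 : w * (WeilDeligneRep.geomFrob F hex ^ (-deg w))⁻¹ ∈ S :=
      hI (mul_inv_mem_inertia_of_deg_eq (by rw [hdeg, neg_neg]))
    have h2 := S.mul_mem h1 (S.zpow_mem hΦS (-deg w))
    rwa [inv_mul_cancel_right] at h2
  exact ⟨u₀, hu, fun w => hS w⟩

/-- **No `W_F`-stable line in `φ ⊗ τ` for `φ` irreducible and `dim τ < dim φ`.**  If `u ∈ V ⊗ W`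
spans a line stable under every `(ρ_φ ⊗ ρ_τ)(w)`, then `u = 0`: the contractions
`Θ u : W^* → V`, `f ↦ (id ⊗ f) u` (any bilinear `Θ` with `Θ (v ⊗ x) f = f x • v`) have a range
which is `ρ_φ`-stable (`ρ_φ(w) (Θ y f) = Θ ((ρ_φ ⊗ ρ_τ)(w) y) (f ∘ ρ_τ(w⁻¹))`), `N_φ`-stable
(`N_φ = 0`, `N_eq_zero_of_isIrreducible`) and of dimension `≤ dim W^* = dim W < dim V`; by
irreducibility it is `0`, and `u = Σ_i Θ u b^*_i ⊗ b_i = 0` for a basis `b` of `W`.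
Ref: Henniart, Bull. SMF 130 (2002), proof of Thm 1.6 (a). [cite: HenniartBSMF2002, Thm 1.6 (a)] -/
theorem eq_zero_of_forall_exists_smul {F : Type*} [Field F] [ValuativeRel F]
    [TopologicalSpace F] [IsNonarchimedeanLocalField F]
    {V : Type*} [AddCommGroup V] [Module ℂ V] [FiniteDimensional ℂ V]
    {W : Type*} [AddCommGroup W] [Module ℂ W] [FiniteDimensional ℂ W]
    (φ : WeilDeligneRep F ℂ V) (τ : WeilDeligneRep F ℂ W) (hφ : φ.IsIrreducible)
    (hVW : finrank ℂ W < finrank ℂ V)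
    (Θ : V ⊗[ℂ] W →ₗ[ℂ] Module.Dual ℂ W →ₗ[ℂ] V)
    (hΘ : ∀ (v : V) (x : W) (f : Module.Dual ℂ W), Θ (v ⊗ₜ x) f = f x • v)
    {u : V ⊗[ℂ] W} (hu : ∀ w : WeilGroup F, ∃ a : ℂ, (φ.tprod τ).ρ w u = a • u) : u = 0 := by
  classical
  -- equivariance of the contraction
  have key : ∀ (w : WeilGroup F) (f : Module.Dual ℂ W) (y : V ⊗[ℂ] W),
      φ.ρ w (Θ y f) = Θ (TensorProduct.map (φ.ρ w) (τ.ρ w) y) (f ∘ₗ τ.ρ w⁻¹) := by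
    intro w f y
    induction y using TensorProduct.induction_on with
    | zero => simp
    | tmul v x =>
      rw [hΘ, TensorProduct.map_tmul, hΘ, map_smul, LinearMap.comp_apply,
        Representation.inv_self_apply]
    | add y z hy hz => simp only [map_add, LinearMap.add_apply, hy, hz]
  -- reconstruction of a tensor from its contractions
  have recon : ∀ y : V ⊗[ℂ] W,
      ∑ i, Θ y ((finBasis ℂ W).coord i) ⊗ₜ[ℂ] (finBasis ℂ W) i = y := by
    intro y
    induction y using TensorProduct.induction_on with
    | zero => simp
    | tmul v x =>
      simp_rw [hΘ, Basis.coord_apply, TensorProduct.smul_tmul, ← TensorProduct.tmul_sum,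
        Basis.sum_repr]
    | add y z hy hz =>
      simp_rw [map_add, LinearMap.add_apply, TensorProduct.add_tmul, Finset.sum_add_distrib, hy, hz]
  -- the range of `Θ u` is a sub-Weil–Deligne representation of `φ`
  have hsub : φ.IsSubrep (LinearMap.range (Θ u)) := by
    refine ⟨fun w => ?_, fun v _ => ?_⟩
    · rintro _ ⟨f, rfl⟩
      obtain ⟨a, ha⟩ := hu w
      rw [WeilDeligneRep.tprod_ρ_apply] at ha
      rw [Submodule.mem_comap, key, ha, map_smul, LinearMap.smul_apply]
      exact Submodule.smul_mem _ a (LinearMap.mem_range_self _ _)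
    · rw [Submodule.mem_comap, N_eq_zero_of_isIrreducible φ hφ, LinearMap.zero_apply]
      exact Submodule.zero_mem _
  rcases hφ.2 _ hsub with h | h
  · have h0 : Θ u = 0 := LinearMap.range_eq_bot.mp h
    calc u = ∑ i, Θ u ((finBasis ℂ W).coord i) ⊗ₜ[ℂ] (finBasis ℂ W) i := (recon u).symm
      _ = 0 := by simp [h0]
  · exfalso
    have h1 : finrank ℂ (LinearMap.range (Θ u)) ≤ finrank ℂ (Module.Dual ℂ W) :=
      LinearMap.finrank_range_le (Θ u)
    rw [Subspace.dual_finrank_eq, h, finrank_top] at h1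
    omega

/-- **The Euler factor of a Weil–Deligne representation with `(ker N)^{I_F} = 0` is `1`**: the
(reversed) characteristic polynomial of an endomorphism of the zero space is `1`
(`WeilDeligneRep.eulerFactor_eq_reverse_charpoly`, `LinearMap.charpoly_natDegree`).
Ref: Tate, *Number theoretic background* (Corvallis 1979), (4.1.6). [cite: Corvallis1979, (4.1.6)] -/
theorem eulerFactor_eq_one_of_inertiaInvariantsKerN_eq_bot {F : Type*} [Field F] [ValuativeRel F]
    [TopologicalSpace F] [IsNonarchimedeanLocalField F]
    (hn : absInertia_normal F) (hex : exists_isFrobPow (F := F))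
    {X : Type*} [AddCommGroup X] [Module ℂ X] [FiniteDimensional ℂ X] (r : WeilDeligneRep F ℂ X)
    (hU : r.inertiaInvariantsKerN = ⊥) : r.eulerFactor hn hex = 1 := by
  rw [r.eulerFactor_eq_reverse_charpoly hn hex (WeilDeligneRep.deg_geomFrob' hex)]
  have h0 : finrank ℂ r.inertiaInvariantsKerN = 0 := Submodule.finrank_eq_zero.mpr hU
  have h1 : (r.restrictInertiaInvariantsKerN hn (WeilDeligneRep.geomFrob F hex)).charpoly = 1 :=
    Polynomial.eq_one_of_monic_natDegree_zero (LinearMap.charpoly_monic _)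
      (by rw [LinearMap.charpoly_natDegree, h0])
  rw [h1]
  simpa using Polynomial.reverse_C (1 : ℂ)

/-- **Stub E1 (Henniart 2002 Thm 1.6 (a), (i) ⇒ (ii), elementary half): an IRREDUCIBLE Weil–Deligne
representation `φ` has trivial Euler factor against every Weil–Deligne representation `τ` of
smaller dimension**, `eulerFactor (φ ⊗ τ) = det(1 - T·Φ | (ker N_{φ⊗τ})^{I_F}) = 1`.  If
`(ker N_{φ⊗τ})^{I_F} ≠ 0`, a Frobenius eigenvector in it spans a `W_F`-stable line
(`exists_forall_exists_smul_of_ne_bot`), impossible by `eq_zero_of_forall_exists_smul`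
(`dim τ < dim φ`, `N_φ = 0`); and the Euler factor of the zero space is `1`
(`eulerFactor_eq_one_of_inertiaInvariantsKerN_eq_bot`).
Ref: G. Henniart, Bull. Soc. Math. France 130 (2002), Thm 1.6 (a). [cite: HenniartBSMF2002, Thm 1.6 (a)] -/
theorem stub_eulerFactor_tprod_eq_one_of_isIrreducible :
    ∀ (F : Type) [Field F] [ValuativeRel F] [TopologicalSpace F] [IsNonarchimedeanLocalField F]
      (hn : absInertia_normal F) (hex : exists_isFrobPow (F := F))
      (V : Type) [AddCommGroup V] [Module ℂ V] [FiniteDimensional ℂ V]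
      (W : Type) [AddCommGroup W] [Module ℂ W] [FiniteDimensional ℂ W]
      (φ : WeilDeligneRep F ℂ V) (τ : WeilDeligneRep F ℂ W),
      φ.IsIrreducible → Module.finrank ℂ W < Module.finrank ℂ V → (φ.tprod τ).eulerFactor hn hex = 1 := by
  intro F _ _ _ _ hn hex V _ _ _ W _ _ _ φ τ hφ hVW
  refine eulerFactor_eq_one_of_inertiaInvariantsKerN_eq_bot hn hex (φ.tprod τ) ?_
  by_contra hU
  obtain ⟨u, hu0, hu⟩ := exists_forall_exists_smul_of_ne_bot hn hex (φ.tprod τ) hU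
  -- the contraction `Θ (v ⊗ x) f = f x • v`
  let Θ : V ⊗[ℂ] W →ₗ[ℂ] Module.Dual ℂ W →ₗ[ℂ] V :=
    TensorProduct.lift
      ((LinearMap.smulRightₗ :
          Module.Dual ℂ (Module.Dual ℂ W) →ₗ[ℂ] V →ₗ[ℂ] Module.Dual ℂ W →ₗ[ℂ] V) ∘ₗ
        Module.Dual.eval ℂ W).flip
  have hΘ : ∀ (v : V) (x : W) (f : Module.Dual ℂ W), Θ (v ⊗ₜ x) f = f x • v :=
      fun v x f => by
    simp only [Θ, TensorProduct.lift.tmul, LinearMap.flip_apply, LinearMap.comp_apply,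
      LinearMap.smulRightₗ_apply, LinearMap.smulRight_apply, Module.Dual.eval_apply]
  exact hu0 (eq_zero_of_forall_exists_smul φ τ hφ hVW Θ hΘ hu)

end Summit.Langlands.Langlands.Theorems.ReciprocityUpToIrreducibilityR
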